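import Summits.KontsevichZagierPeriods.KontsevichZagierPeriods.Theorems.RootDecompRelativeModAbsoluteCircleSplitP02

/-! # `RootDecompRelativeModAbsoluteCircleSplitP03` — part 3/12 of the mechanical ≤400-line split of `csk_min.lean` (sha256 066c56c743abe73e…)
Source: decomp-kz lens-3 g14 CircleSplitK.lean @3d3b9378 (= CircleSplit @d1112051 §0–§25 + §26 kernel split + §27 odd→log; critic CLEARED g6-21 l.1371, g7-2 l.1388) minus the 65 declarations already landed in …CircleLogP1–P11 / …CylLogSplitP46–P49 and minus the 20 superseded g13-glue/tame-class lemmas not on the §26–§27 chain; imports …CylLogSplitP48 + …CircleLogP11; --supports stmt-KontsevichZagierPeriods-30572.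
Split by census-1 g10 `gen/splitlean.py`: scopes re-opened with their `open`/`variable`/`set_option` context; mathematics and declaration order unchanged. -/

noncomputable section
open Set MeasureTheory Filter Topology
open scoped BigOperators
open Literature.NumberTheory.Transcendental Literature.ModelTheory.ExponentialFields
namespace Summit.KontsevichZagierPeriods.RootDecompRelativeModAbsolute.Rung30571.RegularisedLogLayer.CylLog.Leaf
namespace G13
variable {b : ℕ}

/-- **(R1C) — the σ-oriented `CircleBoundaryRigidity` feed, PROVED from `CircleBoundaryRigidity` by name.**  Over an
open `ℚ`-sa base `G`: σ-oriented pure-log cells `U_i` (`σ i`: `[band G 1 W_i, h_i/t]`, `W_i ≥ 1`; `¬σ i`: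
`[band G W_i 1, h_i/t]`, `0 < W_i ≤ 1`, `W_i` differentiable) and arctangent cells `A_j = [band G 0 u_j, p_j/(1+t²)]`
(`u_j ≥ 0`) with `h_i log W_i, p_j arctan u_j ∈ L¹(G)` and `Σ_i h_i log W_i + Σ_j p_j arctan u_j = 0` on `G` ⟹
`Σ_i (if σ i then 1 else −1) • [U_i] + Σ_j [A_j] ∈ KZ.relations`. -/
theorem r1C_of_circleBoundaryRigidity {b : ℕ} (hCBR : CircleBoundaryRigidityAt b)
    {k l : ℕ} {G : Set (Fin b → ℝ)} (hGo : IsOpen G) (hG : IsSemialgebraic ℚ G)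
    (h W : Fin k → (Fin b → ℝ) → ℝ) (hh : ∀ i, IsSemialgebraicFunOn ℚ G (h i))
    (hW : ∀ i, IsSemialgebraicFunOn ℚ G (W i)) (hWd : ∀ i, DifferentiableOn ℝ (W i) G)
    (σ : Fin k → Bool) (hσt : ∀ i, σ i = true → ∀ x ∈ G, 1 ≤ W i x)
    (hσf : ∀ i, σ i = false → ∀ x ∈ G, 0 < W i x ∧ W i x ≤ 1)
    (p u : Fin l → (Fin b → ℝ) → ℝ) (hp : ∀ j, IsSemialgebraicFunOn ℚ G (p j))
    (hu : ∀ j, IsSemialgebraicFunOn ℚ G (u j)) (hu0 : ∀ j, ∀ x ∈ G, 0 ≤ u j x)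
    (hint : ∀ i, IntegrableOn (fun x => h i x * Real.log (W i x)) G)
    (hintA : ∀ j, IntegrableOn (fun x => p j x * Real.arctan (u j x)) G)
    (hsum : ∀ x ∈ G, ∑ i, h i x * Real.log (W i x) + ∑ j, p j x * Real.arctan (u j x) = 0)
    (U : Fin k → KZ.IntegralRep (b + 1))
    (hUd : ∀ i, (U i).domain =
      if σ i then KZlog.band G (fun _ => 1) (W i) else KZlog.band G (W i) (fun _ => 1))
    (hUi : ∀ i, EqOn (U i).integrand (fun z => h i (Fin.init z) / z (Fin.last b)) (U i).domain)
    (A : Fin l → KZ.IntegralRep (b + 1))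
    (hAd : ∀ j, (A j).domain = {z | (Fin.init z : Fin b → ℝ) ∈ G ∧ 0 ≤ z (Fin.last b) ∧
      z (Fin.last b) ≤ u j (Fin.init z)})
    (hAi : ∀ j, EqOn (A j).integrand (fun z => p j (Fin.init z) / (1 + z (Fin.last b) ^ 2)) (A j).domain) :
    ∑ i, (if σ i then (1:ℤ) else -1) • KZ.of (U i) + ∑ j, KZ.of (A j) ∈ KZ.relations := by
  have hW0 : ∀ i, ∀ x ∈ G, 0 < W i x := fun i x hx => by
    cases hσ : σ i
    · exact (hσf i hσ x hx).1
    · linarith [hσt i hσ x hx]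
  have h1sa : IsSemialgebraicFunOn ℚ G (fun _ => (1:ℝ)) :=
    (isSemialgebraicFunOn_ratCast hG 1).congr fun _ _ => by simp
  have hWinv : ∀ i, IsSemialgebraicFunOn ℚ G (fun x => (W i x)⁻¹) := fun i =>
    (IsSemialgebraicFunOn.div h1sa (hW i) fun x hx => (hW0 i x hx).ne').congr fun x _ => by simp
  have hhneg : ∀ i, IsSemialgebraicFunOn ℚ G (fun x => -h i x) := fun i => (hh i).neg
  have hex : ∀ i, ∃ Ut Um : KZ.IntegralRep (b + 1), σ i = false →
      Ut.domain = KZlog.band G (fun _ => 1) (fun x => (W i x)⁻¹) ∧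
      (Ut.integrand = fun z => h i (Fin.init z) / z (Fin.last b)) ∧
      Um.domain = KZlog.band G (fun _ => 1) (fun x => (W i x)⁻¹) ∧
      (Um.integrand = fun z => -h i (Fin.init z) / z (Fin.last b)) := by
    intro i
    cases hσ : σ i
    · have hW1' : ∀ x ∈ G, 1 ≤ (W i x)⁻¹ := fun x hx =>
        (one_le_inv₀ (hσf i hσ x hx).1).2 (hσf i hσ x hx).2
      have hint' : IntegrableOn (fun x => h i x * Real.log ((W i x)⁻¹)) G :=
        (hint i).neg.congr_fun (fun x _ => by simp [Real.log_inv]) hG.measurableSet_holds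
      have hint'' : IntegrableOn (fun x => -h i x * Real.log ((W i x)⁻¹)) G :=
        (hint i).congr_fun (fun x _ => by simp [Real.log_inv]) hG.measurableSet_holds
      obtain ⟨Ut, hUtd, hUti⟩ := exists_logRep_of_integrableOn_log hG (hh i) (hWinv i) hW1' hint'
      obtain ⟨Um, hUmd, hUmi⟩ := exists_logRep_of_integrableOn_log hG (hhneg i) (hWinv i) hW1' hint''
      exact ⟨Ut, Um, fun _ => ⟨hUtd, hUti, hUmd, hUmi⟩⟩
    · exact ⟨U i, U i, fun h => absurd h (by simp)⟩
  choose Ut Um hUtm using hex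
  let h' : Fin k → (Fin b → ℝ) → ℝ := fun i => if σ i then h i else fun x => -h i x
  let W' : Fin k → (Fin b → ℝ) → ℝ := fun i => if σ i then W i else fun x => (W i x)⁻¹
  let V : Fin k → KZ.IntegralRep (b + 1) := fun i => if σ i then U i else Um i
  have hVf : ∀ i, σ i = false → V i = Um i := fun i hσ => by simp [V, hσ]
  have hVt : ∀ i, σ i = true → V i = U i := fun i hσ => by simp [V, hσ]
  have hWf : ∀ i, σ i = false → W' i = fun x => (W i x)⁻¹ := fun i hσ => by simp [W', hσ]
  have hWt : ∀ i, σ i = true → W' i = W i := fun i hσ => by simp [W', hσ]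
  have hhf : ∀ i, σ i = false → h' i = fun x => -h i x := fun i hσ => by simp [h', hσ]
  have hht : ∀ i, σ i = true → h' i = h i := fun i hσ => by simp [h', hσ]
  obtain ⟨g, hgd, hgi⟩ := KZ.exists_zeroRep hG
  have hh' : ∀ i, IsSemialgebraicFunOn ℚ g.domain (h' i) := fun i => by
    rw [hgd]
    cases hσ : σ i
    · rw [hhf i hσ]; exact hhneg i
    · rw [hht i hσ]; exact hh i
  have hW' : ∀ i, IsSemialgebraicFunOn ℚ g.domain (W' i) := fun i => by
    rw [hgd]
    cases hσ : σ i
    · rw [hWf i hσ]; exact hWinv i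
    · rw [hWt i hσ]; exact hW i
  have hp' : ∀ j, IsSemialgebraicFunOn ℚ g.domain (p j) := fun j => by rw [hgd]; exact hp j
  have hu' : ∀ j, IsSemialgebraicFunOn ℚ g.domain (u j) := fun j => by rw [hgd]; exact hu j
  have hu0' : ∀ j, ∀ x ∈ g.domain, 0 ≤ u j x := fun j x hx => by rw [hgd] at hx; exact hu0 j x hx
  have hW'1 : ∀ i, ∀ x ∈ g.domain, 1 ≤ W' i x := fun i x hx => by
    rw [hgd] at hx
    cases hσ : σ i
    · simp only [hWf i hσ]
      exact (one_le_inv₀ (hσf i hσ x hx).1).2 (hσf i hσ x hx).2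
    · simp only [hWt i hσ]
      exact hσt i hσ x hx
  have hterm : ∀ i, ∀ x ∈ G, h' i x * Real.log (W' i x) = h i x * Real.log (W i x) := fun i x hx => by
    cases hσ : σ i
    · simp [hhf i hσ, hWf i hσ, Real.log_inv]
    · simp [hht i hσ, hWt i hσ]
  have hVd : ∀ i, (V i).domain = {z | (Fin.init z : Fin b → ℝ) ∈ g.domain ∧ 1 ≤ z (Fin.last b) ∧
      z (Fin.last b) ≤ W' i (Fin.init z)} := fun i => by
    rw [hgd]
    cases hσ : σ i
    · rw [hVf i hσ, (hUtm i hσ).2.2.1, hWf i hσ]; rfl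
    · rw [hVt i hσ, hUd i, if_pos hσ, hWt i hσ]; rfl
  have hVi : ∀ i, EqOn (V i).integrand (fun z => h' i (Fin.init z) / z (Fin.last b)) (V i).domain :=
    fun i => by
    cases hσ : σ i
    · rw [hVf i hσ, (hUtm i hσ).2.2.2, hhf i hσ]; exact fun z _ => rfl
    · rw [hVt i hσ, hht i hσ]; exact hUi i
  have hAd' : ∀ j, (A j).domain = {z | (Fin.init z : Fin b → ℝ) ∈ g.domain ∧ 0 ≤ z (Fin.last b) ∧
      z (Fin.last b) ≤ u j (Fin.init z)} := fun j => by rw [hgd]; exact hAd j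
  have hVint : ∀ i, IntegrableOn (fun x => h' i x * Real.log (W' i x)) g.domain := fun i => by
    rw [hgd]; exact (hint i).congr_fun (fun x hx => (hterm i x hx).symm) hG.measurableSet_holds
  have hintA' : ∀ j, IntegrableOn (fun x => p j x * Real.arctan (u j x)) g.domain := fun j => by
    rw [hgd]; exact hintA j
  have hgsum : ∀ x ∈ g.domain, g.integrand x =
      ∑ i, h' i x * Real.log (W' i x) + ∑ j, p j x * Real.arctan (u j x) := fun x hx => by
    rw [hgd] at hx
    rw [hgi, Finset.sum_congr rfl fun i _ => hterm i x hx, hsum x hx]; rfl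
  have hBR' := hCBR k l g h' W' p u V A hh' hW' hp' hu' hW'1 hu0' hVd hVi hAd' hAi hVint hintA' hgsum
  have hg0 : KZ.of g ∈ KZ.relations :=
    KZ.of_mem_relations_of_eqOn_zero g (by rw [hgi]; exact fun _ _ => rfl)
  have hdiff : ∀ i, (if σ i then (1:ℤ) else -1) • KZ.of (U i) - KZ.of (V i) ∈ KZ.relations := fun i => by
    cases hσ : σ i
    · obtain ⟨hUtd, hUti, hUmd, hUmi⟩ := hUtm i hσ
      have h1 : KZ.of (Ut i) - KZ.of (U i) ∈ KZ.relations :=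
        logCell_reorient_mem_relations hGo hG (hW i) (hWd i) (hW0 i) (Ut i) (U i) hUtd
          (by rw [hUti]; exact fun _ _ => rfl) (by rw [hUd i, if_neg (by simp [hσ])]) (hUi i)
      have h2 : KZ.of (Ut i) + KZ.of (Um i) ∈ KZ.relations :=
        KZ.of_add_of_mem_relations_of_eqOn_neg (by rw [hUmd, hUtd])
          (by rw [hUmi, hUti]; intro z _; simp [neg_div])
      have : (if false = true then (1:ℤ) else -1) • KZ.of (U i) - KZ.of (V i) =
          (KZ.of (Ut i) - KZ.of (U i)) - (KZ.of (Ut i) + KZ.of (Um i)) := by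
        rw [if_neg (by simp), hVf i hσ, neg_smul, one_smul]; abel
      rw [this]
      exact KZ.relations.sub_mem h1 h2
    · have : (if true = true then (1:ℤ) else -1) • KZ.of (U i) - KZ.of (V i) = 0 := by
        rw [if_pos rfl, hVt i hσ, one_smul, sub_self]
      rw [this]
      exact KZ.relations.zero_mem
  have hS : ∑ i, (if σ i then (1:ℤ) else -1) • KZ.of (U i) - ∑ i, KZ.of (V i) ∈ KZ.relations := by
    rw [← Finset.sum_sub_distrib]
    exact sum_mem fun i _ => hdiff i
  have : ∑ i, (if σ i then (1:ℤ) else -1) • KZ.of (U i) + ∑ j, KZ.of (A j) =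
      (∑ i, (if σ i then (1:ℤ) else -1) • KZ.of (U i) - ∑ i, KZ.of (V i)) +
        (∑ i, KZ.of (V i) + ∑ j, KZ.of (A j) - KZ.of g) + KZ.of g := by abel
  rw [this]
  exact KZ.relations.add_mem (KZ.relations.add_mem hS hBR') hg0

/-! ## §6 THE CIRCLE ENGINE (PROVED): the scaling move cylinder → circle band `t = θ√κ`, honest circle-band
representations from a base majorant, the circle order-lowering step `t^{m+2}/(1+t²) + t^m/(1+t²) = t^m` with its
base term and the circle ORDER TELESCOPE; plus token-identical copies of the g11 consolidation / honesty lemmas of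
`…CylLogSplitP26` (landing in parallel; not yet built on the farm — drop the copies once it is). -/

/-- **Honest circle-band representation from a base majorant:** for `ℚ`-sa `p, u ≥ 0` on `G`, a majorant
`K ≥ ∫_{[0,u]} t^m/(1+t²)` with `p·K ∈ L¹(G)` makes `[band G 0 u, p t^m/(1+t²)]` an honest representation. -/
theorem exists_circBandRep {b m : ℕ} {G : Set (Fin b → ℝ)} {p u K : (Fin b → ℝ) → ℝ}
    (hG : IsSemialgebraic ℚ G) (hp : IsSemialgebraicFunOn ℚ G p) (hu : IsSemialgebraicFunOn ℚ G u)
    (hK : ∀ x ∈ G, ∫ t in Icc 0 (u x), t ^ m / (1 + t ^ 2) ≤ K x)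
    (hint : IntegrableOn (fun x => p x * K x) G) :
    ∃ Q : KZ.IntegralRep (b + 1), Q.domain = KZlog.band G (fun _ => 0) u ∧
      Q.integrand = fun z => p (Fin.init z) * (z (Fin.last b) ^ m / (1 + z (Fin.last b) ^ 2)) := by
  have h0sa : IsSemialgebraicFunOn ℚ G (fun _ => (0:ℝ)) :=
    (isSemialgebraicFunOn_ratCast hG 0).congr fun _ _ => by simp
  set Bd := KZlog.band G (fun _ => (0:ℝ)) u with hBd_def
  have hbsa : IsSemialgebraic ℚ Bd := KZlog.isSemialgebraic_band h0sa hu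
  have hGm : MeasurableSet G := hG.measurableSet_holds
  have hBm : MeasurableSet Bd := hbsa.measurableSet_holds
  have hband_sub : Bd ⊆ {z : Fin (b + 1) → ℝ | Fin.init z ∈ G} := fun z hz => hz.1
  have hpI : IsSemialgebraicFunOn ℚ Bd (fun z => p (Fin.init z)) := hp.comp_init.mono hband_sub hbsa
  have hsI : IsSemialgebraicFunOn ℚ Bd (fun z => z (Fin.last b)) := Literature.NumberTheory.Transcendental.isSemialgebraicFunOn_apply hbsa (Fin.last b)
  have hden : IsSemialgebraicFunOn ℚ Bd (fun z => 1 + z (Fin.last b) ^ 2) :=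
    IsSemialgebraicFunOn.add_holds ((isSemialgebraicFunOn_ratCast hbsa 1).congr fun _ _ => by simp)
      (isSemialgebraicFunOn_pow' hbsa hsI 2)
  have hden0 : ∀ z ∈ Bd, 1 + z (Fin.last b) ^ 2 ≠ 0 := fun z _ => by positivity
  have hRsa : IsSemialgebraicFunOn ℚ Bd (fun z => p (Fin.init z) * (z (Fin.last b) ^ m / (1 + z (Fin.last b) ^ 2))) :=
    IsSemialgebraicFunOn.mul_holds hpI (IsSemialgebraicFunOn.div (isSemialgebraicFunOn_pow' hbsa hsI m) hden hden0)
  have hRint : IntegrableOn (fun z : Fin (b + 1) → ℝ => p (Fin.init z) *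
      (z (Fin.last b) ^ m / (1 + z (Fin.last b) ^ 2))) Bd := by
    refine KZlog.integrableOn_band_of_lintegral_fibre_le hGm (a := fun _ => (0:ℝ)) (b := u) hBm
      (fun x t => KZlog.snoc_mem_band) (KZ.aestronglyMeasurable_of_isSemialgebraicFunOn hRsa hBm)
      (K := fun x => p x * K x) (fun x hx => ?_) hint
    simp only [Fin.init_snoc, Fin.snoc_last]
    have hden' : ∀ t : ℝ, 1 + t ^ 2 ≠ 0 := fun t => by positivity
    have hg_cont : Continuous fun t : ℝ => p x * (t ^ m / (1 + t ^ 2)) :=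
      continuous_const.mul ((continuous_pow m).div (continuous_const.add (continuous_pow 2)) hden')
    have hg_int : IntegrableOn (fun t : ℝ => p x * (t ^ m / (1 + t ^ 2))) (Icc 0 (u x)) :=
      hg_cont.continuousOn.integrableOn_compact isCompact_Icc
    rw [← ofReal_integral_norm_eq_lintegral_enorm hg_int]
    have hknn : ∀ t ∈ Icc 0 (u x), 0 ≤ t ^ m / (1 + t ^ 2) := fun t ht =>
      div_nonneg (pow_nonneg ht.1 m) (by positivity)
    have hI0 : 0 ≤ ∫ t in Icc 0 (u x), t ^ m / (1 + t ^ 2) := setIntegral_nonneg measurableSet_Icc hknn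
    have hKx : 0 ≤ K x := hI0.trans (hK x hx)
    have heq : ∫ t in Icc 0 (u x), ‖p x * (t ^ m / (1 + t ^ 2))‖ =
        |p x| * ∫ t in Icc 0 (u x), t ^ m / (1 + t ^ 2) := by
      rw [← integral_const_mul]
      refine setIntegral_congr_fun measurableSet_Icc fun t ht => ?_
      rw [norm_mul, Real.norm_eq_abs, Real.norm_eq_abs, abs_of_nonneg (hknn t ht)]
    rw [heq]
    calc ENNReal.ofReal (|p x| * ∫ t in Icc 0 (u x), t ^ m / (1 + t ^ 2))
        ≤ ENNReal.ofReal (|p x| * K x) :=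
          ENNReal.ofReal_le_ofReal (mul_le_mul_of_nonneg_left (hK x hx) (abs_nonneg _))
      _ = ‖p x * K x‖ₑ := by rw [Real.enorm_eq_ofReal_abs, abs_mul, abs_of_nonneg hKx]
  exact ⟨{ domain := Bd
           integrand := fun z => p (Fin.init z) * (z (Fin.last b) ^ m / (1 + z (Fin.last b) ^ 2))
           isSemialgebraic_domain := hbsa
           isSemialgebraicFunOn_integrand := hRsa
           integrableOn := hRint }, rfl, rfl⟩

/-- **Circle order lowering (one step).** On the band `[0, u]` with coefficient `p`:
`[band, p t^{m+2}/(1+t²)] + [band, p t^m/(1+t²)] − [G, p u^{m+1}/(m+1)] ∈ KZ.relations`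
(rules 1b + 3: `t^{m+2}/(1+t²) + t^m/(1+t²) = t^m` is a polynomial band). -/
theorem circOrder_lower {b m : ℕ} {G : Set (Fin b → ℝ)} {p u : (Fin b → ℝ) → ℝ}
    (hG : IsSemialgebraic ℚ G) (hp : IsSemialgebraicFunOn ℚ G p) (hu : IsSemialgebraicFunOn ℚ G u)
    (hu0 : ∀ x ∈ G, 0 ≤ u x)
    (P Q : KZ.IntegralRep (b + 1)) (B₀ : KZ.IntegralRep b) (hPd : P.domain = KZlog.band G (fun _ => 0) u)
    (hPi : EqOn P.integrand
      (fun z => p (Fin.init z) * (z (Fin.last b) ^ (m + 2) / (1 + z (Fin.last b) ^ 2))) P.domain)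
    (hQd : Q.domain = KZlog.band G (fun _ => 0) u)
    (hQi : EqOn Q.integrand
      (fun z => p (Fin.init z) * (z (Fin.last b) ^ m / (1 + z (Fin.last b) ^ 2))) Q.domain)
    (hBd : B₀.domain = G)
    (hBi : EqOn B₀.integrand (fun x => p x * (u x ^ (m + 1) / (m + 1))) B₀.domain) :
    KZ.of P + KZ.of Q - KZ.of B₀ ∈ KZ.relations := by
  have h0sa : IsSemialgebraicFunOn ℚ G (fun _ => (0:ℝ)) :=
    (isSemialgebraicFunOn_ratCast hG 0).congr fun _ _ => by simp
  have hbpq : IsSemialgebraic ℚ (KZlog.band G (fun _ => (0:ℝ)) u) := KZlog.isSemialgebraic_band h0sa hu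
  have hBm : MeasurableSet (KZlog.band G (fun _ => (0:ℝ)) u) := hbpq.measurableSet_holds
  have hband_sub : KZlog.band G (fun _ => (0:ℝ)) u ⊆ {z : Fin (b + 1) → ℝ | Fin.init z ∈ G} := fun z hz => hz.1
  have hpI : IsSemialgebraicFunOn ℚ (KZlog.band G (fun _ => (0:ℝ)) u) (fun z => p (Fin.init z)) :=
    hp.comp_init.mono hband_sub hbpq
  have hsI : IsSemialgebraicFunOn ℚ (KZlog.band G (fun _ => (0:ℝ)) u) (fun z => z (Fin.last b)) :=
    Literature.NumberTheory.Transcendental.isSemialgebraicFunOn_apply hbpq (Fin.last b)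
  have hPolysa : IsSemialgebraicFunOn ℚ (KZlog.band G (fun _ => (0:ℝ)) u)
      (fun z => p (Fin.init z) * z (Fin.last b) ^ m) :=
    IsSemialgebraicFunOn.mul_holds hpI (isSemialgebraicFunOn_pow' hbpq hsI m)
  have hsum : ∀ z ∈ KZlog.band G (fun _ => (0:ℝ)) u,
      P.integrand z + Q.integrand z = p (Fin.init z) * z (Fin.last b) ^ m := by
    intro z hz
    rw [hPi (hPd ▸ hz), hQi (hQd ▸ hz)]
    have h0 : 1 + z (Fin.last b) ^ 2 ≠ 0 := by positivity
    field_simp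
    ring
  have hPolyint : IntegrableOn (fun z : Fin (b + 1) → ℝ => p (Fin.init z) * z (Fin.last b) ^ m)
      (KZlog.band G (fun _ => (0:ℝ)) u) := by
    have h1 : IntegrableOn P.integrand (KZlog.band G (fun _ => (0:ℝ)) u) := by rw [← hPd]; exact P.integrableOn
    have h2 : IntegrableOn Q.integrand (KZlog.band G (fun _ => (0:ℝ)) u) := by rw [← hQd]; exact Q.integrableOn
    exact (h1.add h2).congr_fun hsum hBm
  let Poly : KZ.IntegralRep (b + 1) :=
    { domain := KZlog.band G (fun _ => (0:ℝ)) u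
      integrand := fun z => p (Fin.init z) * z (Fin.last b) ^ m
      isSemialgebraic_domain := hbpq
      isSemialgebraicFunOn_integrand := hPolysa
      integrableOn := hPolyint }
  have hadd : KZ.of Poly - KZ.of P - KZ.of Q ∈ KZ.relations :=
    KZ.integrandAddRel_subset_relations ⟨b + 1, Poly, P, Q, hPd, hQd,
      fun z hz => by simpa [Poly] using (hsum z hz).symm, rfl⟩
  set F : (Fin (b + 1) → ℝ) → ℝ := fun z =>
    p (Fin.init z) * (z (Fin.last b) ^ (m + 1) / (m + 1)) with hF
  have hFsa : IsSemialgebraicFunOn ℚ Poly.domain F := by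
    have hk : IsSemialgebraicFunOn ℚ (KZlog.band G (fun _ => (0:ℝ)) u) (fun _ => ((m : ℝ) + 1)⁻¹) :=
      (isSemialgebraicFunOn_ratCast hbpq (((m : ℚ) + 1)⁻¹)).congr fun z _ => by push_cast; ring
    exact (IsSemialgebraicFunOn.mul_holds hpI (IsSemialgebraicFunOn.mul_holds
      (isSemialgebraicFunOn_pow' hbpq hsI (m + 1)) hk)).congr fun z _ => by
        simp [hF, div_eq_mul_inv]
  have hNL : KZ.of Poly - KZ.of B₀ ∈ KZ.relations := by
    refine KZ.newtonLeibnizRel_subset_relations ⟨b, Poly, B₀, fun _ => 0, u, F, hFsa, ?_, ?_, ?_, ?_,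
      ?_, ?_, ?_, rfl⟩
    · rw [hBd]; exact h0sa
    · rw [hBd]; exact hu
    · rw [hBd]; exact hu0
    · rw [hBd]; rfl
    · intro x _
      have hcont : Continuous fun t : ℝ => F (Fin.snoc x t) := by
        simp only [hF, Fin.init_snoc, Fin.snoc_last]
        fun_prop
      exact hcont.continuousOn
    · intro x _ t _
      have h1 : HasDerivAt (fun s : ℝ => s ^ (m + 1) / ((m : ℝ) + 1))
          (((m + 1 : ℕ) : ℝ) * t ^ m / ((m : ℝ) + 1)) t := by
        simpa using ((hasDerivAt_pow (m + 1) t)).div_const ((m : ℝ) + 1)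
      have h2 := h1.const_mul (p x)
      have hM : ((m : ℝ) + 1) ≠ 0 := by positivity
      have hval : p x * ((((m + 1 : ℕ) : ℝ)) * t ^ m / ((m : ℝ) + 1)) = p x * t ^ m := by
        rw [Nat.cast_add_one, mul_comm ((m : ℝ) + 1) (t ^ m), mul_div_assoc, div_self hM, mul_one]
      rw [hval] at h2
      have hPz : Poly.integrand (Fin.snoc x t) = p x * t ^ m := by simp [Poly]
      rw [hPz]
      simp only [hF, Fin.init_snoc, Fin.snoc_last]
      exact h2
    · intro x hx
      rw [hBi hx]
      simp only [hF, Fin.init_snoc, Fin.snoc_last]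
      simp
  have e : KZ.of P + KZ.of Q - KZ.of B₀ = -(KZ.of Poly - KZ.of P - KZ.of Q) + (KZ.of Poly - KZ.of B₀) := by
    abel
  rw [e]
  exact add_mem (neg_mem hadd) hNL

/-- **Circle order telescope.** On the band `[0, u]` with coefficient `p` and parity `r`: honest cells
`P n = [band, p t^{2n+r}/(1+t²)]` (`n ≤ N`) and base terms `B n = [G, p u^{2n+r+1}/(2n+r+1)]` (`n < N`) give
`[P 0] − ((−1)^N•[P N] + Σ_{n<N} (−1)^n•[B n]) ∈ KZ.relations`. -/
theorem circOrder_telescope {b r N : ℕ} {G : Set (Fin b → ℝ)} {p u : (Fin b → ℝ) → ℝ}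
    (hG : IsSemialgebraic ℚ G) (hp : IsSemialgebraicFunOn ℚ G p) (hu : IsSemialgebraicFunOn ℚ G u)
    (hu0 : ∀ x ∈ G, 0 ≤ u x) (P : ℕ → KZ.IntegralRep (b + 1)) (B : ℕ → KZ.IntegralRep b)
    (hPd : ∀ n, n ≤ N → (P n).domain = KZlog.band G (fun _ => 0) u)
    (hPi : ∀ n, n ≤ N → EqOn (P n).integrand
      (fun z => p (Fin.init z) * (z (Fin.last b) ^ (2 * n + r) / (1 + z (Fin.last b) ^ 2))) (P n).domain)
    (hBd : ∀ n, n < N → (B n).domain = G)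
    (hBi : ∀ n, n < N → EqOn (B n).integrand
      (fun x => p x * (u x ^ (2 * n + r + 1) / ((2 * n + r : ℕ) + 1))) (B n).domain) :
    KZ.of (P 0) - ((-1:ℤ) ^ N • KZ.of (P N) +
      ∑ n ∈ Finset.range N, (-1:ℤ) ^ n • KZ.of (B n)) ∈ KZ.relations := by
  have key : ∀ K, K ≤ N → KZ.of (P 0) - ((-1:ℤ) ^ K • KZ.of (P K) +
      ∑ n ∈ Finset.range K, (-1:ℤ) ^ n • KZ.of (B n)) ∈ KZ.relations := by
    intro K
    induction K with
    | zero =>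
      intro _
      simp only [pow_zero, one_smul, Finset.range_zero, Finset.sum_empty, add_zero, sub_self]
      exact KZ.relations.zero_mem
    | succ n ih =>
      intro hn
      have hn' : n ≤ N := by omega
      have X := ih hn'
      have hPi' : EqOn (P (n + 1)).integrand
          (fun z => p (Fin.init z) * (z (Fin.last b) ^ (2 * n + r + 2) / (1 + z (Fin.last b) ^ 2)))
          (P (n + 1)).domain := fun z hz => by
        rw [hPi (n + 1) hn hz, show 2 * (n + 1) + r = 2 * n + r + 2 by ring]
      have R : KZ.of (P (n + 1)) + KZ.of (P n) - KZ.of (B n) ∈ KZ.relations :=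
        circOrder_lower (m := 2 * n + r) hG hp hu hu0 (P (n + 1)) (P n) (B n)
          (hPd _ hn) hPi' (hPd _ hn') (hPi _ hn') (hBd _ (by omega)) (hBi _ (by omega))
      have : KZ.of (P 0) - ((-1:ℤ) ^ (n + 1) • KZ.of (P (n + 1)) +
          ∑ j ∈ Finset.range (n + 1), (-1:ℤ) ^ j • KZ.of (B j)) =
          (KZ.of (P 0) - ((-1:ℤ) ^ n • KZ.of (P n) + ∑ j ∈ Finset.range n, (-1:ℤ) ^ j • KZ.of (B j))) +
          (-1:ℤ) ^ n • (KZ.of (P (n + 1)) + KZ.of (P n) - KZ.of (B n)) := by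
        rw [Finset.sum_range_succ, pow_succ]
        module
      rw [this]
      exact KZ.relations.add_mem X (KZ.relations.zsmul_mem R _)
  exact key N le_rfl

end G13
end Summit.KontsevichZagierPeriods.RootDecompRelativeModAbsolute.Rung30571.RegularisedLogLayer.CylLog.Leaf
end
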